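import Summits.HodgeConjecture.HodgeConjecture.Theorems.HeckePrymWeilWeilVariationalHodgeReductions
import Summits.HodgeConjecture.HodgeConjecture.Theorems.HeckePrymWeilWeilVariationalHodgeLowRungs
import Summits.HodgeConjecture.HodgeConjecture.Theorems.HeckePrymWeilWeilVariationalHodgeSectionedCurveReduction
import Summits.HodgeConjecture.HodgeConjecture.Theorems.HeckePrymWeilWeilVariationalHodgeCurveDichotomy
import Literature.AlgebraicGeometry.Motives.AbelianSchemeProjective

/-!
# Skeleton v5 (lead c3) of line `Sketch` for crux stmt-HodgeConjecture-14497 `HeckePrymWeil.WeilVariationalHodge`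

v4 → v5 (same session): stub 1 `stub_sectionedCurveReduction` LANDED (p142539,
`Theorems/HeckePrymWeilWeilVariationalHodgeSectionedCurveReduction.lean`), stub 3 `stub_curveDichotomy` LANDED
(p141888, `Theorems/HeckePrymWeilWeilVariationalHodgeCurveDichotomy.lean`), and the fact behind stub 2 was vendored
and accepted as the Literature named fact `Motives.raynaud1970_abelianScheme_section_projective` (p143462,
`Literature/AlgebraicGeometry/Motives/AbelianSchemeProjective.lean`: Laurent–Schröer 2023 Prop. 4.3 / GIT 6.14 +
Raynaud 1970 XI 1.4 = Görtz–Wedhorn II Thm. 27.291). The crux AS TYPED now follows from exactly two stubs: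

* `stub_raynaudAbelianSchemeProjective` — the named fact itself (fact-level debt: a smooth proper family with a
  section and abelian complex fibres over a smooth affine `ℂ`-scheme is H-projective);
* `stub_anchorSpreadsUncountably` — the core (lead): along a SECTIONED smooth projective family of abelian
  `2M`-folds with `√-p`-multiplication, `M ≥ 2`, with quasi-projective total space over a smooth irreducible
  affine CURVE, one algebraic fibre of a fibrewise-rational `(M,M)` global class forces UNCOUNTABLY many.

Composition (all other ingredients landed): `weilVariationalHodge_iff_two_le` (rung `M = 1` = Lefschetz `(1,1)`,
p140813) ∘ `stub_affineReduction` (p138186) ∘ `stub_sectionedCurveReduction` (p142539) ∘ `weilRung_sectionedCurve`,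
where over the sectioned curve the fact gives quasi-projectivity (`isQuasiProjectiveOver_of_isClosedImmersion_of_isAffine`),
`stub_curveDichotomy` (p141888) says the algebraicity locus is everything or countable, and the core excludes
countable. `WeilVariationalHodge_of` concludes the crux by name.
-/

noncomputable section

set_option linter.dupNamespace false

open CategoryTheory AlgebraicGeometry TopologicalSpace MonoidalCategory
open Literature.AlgebraicGeometry.Motives Literature.AlgebraicGeometry.HodgeTheory
open Summit.HodgeConjecture.HodgeConjecture.Theses

namespace Summit.HodgeConjecture.HodgeConjecture.Theorems

/-- STUB (fact-level): the vendored named fact `raynaud1970_abelianScheme_section_projective` (Laurent–Schröer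
2023 Prop. 4.3 / GIT 6.14: a sectioned smooth proper family with abelian fibres is an abelian scheme; Raynaud
1970 XI 1.4 = Görtz–Wedhorn II 27.291: abelian schemes over a normal base are projective). -/
theorem stub_raynaudAbelianSchemeProjective : raynaud1970_abelianScheme_section_projective := by
  sorry

/-- STUB (the core, held by the lead): along a sectioned smooth projective family of abelian `2M`-folds with
`√-p`-multiplication (`M ≥ 2`) and quasi-projective total space over a smooth irreducible affine curve, ONE
algebraic fibre of a fibrewise-rational `(M,M)` global class forces UNCOUNTABLY many algebraic fibres. -/
theorem stub_anchorSpreadsUncountably (p M : ℕ) (hp : p.Prime) (hp4 : p % 4 = 3) (hp7 : 7 ≤ p) (hM : 2 ≤ M) :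
    ∀ ⦃𝒳 C : SchemeOver ℂ⦄ (f : 𝒳 ⟶ C) (e : C ⟶ 𝒳), e ≫ f = 𝟙 C → IsSmoothProjectiveFamily f (2 * M) →
      IsQuasiProjectiveOver 𝒳 → IrreducibleSpace C.left → IsAffine C.left → AlgebraicGeometry.Smooth C.hom →
      topologicalKrullDim C.left = 1 → ∀ (W : complexBetti 𝒳 (2 * M)),
      (∀ s : ComplexPoints C, IsRationalClass (complexBetti.map (fiberι f s) (2 * M) W) ∧
        IsOfHodgeType (2 * M) (fiberOver f s) (2 * M) M M (complexBetti.map (fiberι f s) (2 * M) W)) →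
      (∀ s : ComplexPoints C, ∃ (A' : AbelianVariety ℂ) (φ' : A' ⟶ A'), A'.dim = (2 * M) ∧
        φ' ≫ φ' = -((p : ℤ) • 𝟙 A') ∧ Nonempty (A'.X ≅ fiberOver f s)) →
      (∃ s₀ : ComplexPoints C, complexBetti.map (fiberι f s₀) (2 * M) W ∈ algebraicClasses (fiberOver f s₀) M) →
      ¬ Set.Countable {t : ComplexPoints C |
          complexBetti.map (fiberι f t) (2 * M) W ∈ algebraicClasses (fiberOver f t) M} := by
  sorry

/-- GLUE: quasi-projective total space of a sectioned smooth projective family with abelian complex fibres over a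
smooth affine base, from the fact-level stub (`isQuasiProjectiveOver_of_isClosedImmersion_of_isAffine`). -/
theorem isQuasiProjectiveOver_of_sectioned_abelianFibres {n : ℕ} {𝒳 C : SchemeOver ℂ} (f : 𝒳 ⟶ C)
    (e : C ⟶ 𝒳) (he : e ≫ f = 𝟙 C) (hf : IsSmoothProjectiveFamily f n) [IsAffine C.left]
    [AlgebraicGeometry.Smooth C.hom]
    (hA : ∀ s : ComplexPoints C, ∃ A' : AbelianVariety ℂ, Nonempty (A'.X ≅ fiberOver f s)) :
    IsQuasiProjectiveOver 𝒳 :=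
  isQuasiProjectiveOver_of_isClosedImmersion_of_isAffine
    (stub_raynaudAbelianSchemeProjective f e he hf.smooth hf.isProper ‹_› ‹_› hA)

/-- GLUE over a sectioned curve: quasi-projectivity (fact stub), the dichotomy (`stub_curveDichotomy`, landed) and
uncountability (core stub) give the rung for sectioned families over smooth irreducible affine curves, `M ≥ 2`. -/
theorem weilRung_sectionedCurve (p M : ℕ) (hp : p.Prime) (hp4 : p % 4 = 3) (hp7 : 7 ≤ p) (hM : 2 ≤ M) :
    ∀ ⦃𝒳 C : SchemeOver ℂ⦄ (f : 𝒳 ⟶ C) (e : C ⟶ 𝒳), e ≫ f = 𝟙 C → IsSmoothProjectiveFamily f (2 * M) →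
      IrreducibleSpace C.left → IsAffine C.left → AlgebraicGeometry.Smooth C.hom →
      topologicalKrullDim C.left = 1 → ∀ (W : complexBetti 𝒳 (2 * M)),
      (∀ s : ComplexPoints C, IsRationalClass (complexBetti.map (fiberι f s) (2 * M) W) ∧
        IsOfHodgeType (2 * M) (fiberOver f s) (2 * M) M M (complexBetti.map (fiberι f s) (2 * M) W)) →
      (∀ s : ComplexPoints C, ∃ (A' : AbelianVariety ℂ) (φ' : A' ⟶ A'), A'.dim = (2 * M) ∧
        φ' ≫ φ' = -((p : ℤ) • 𝟙 A') ∧ Nonempty (A'.X ≅ fiberOver f s)) →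
      (∃ s₀ : ComplexPoints C, complexBetti.map (fiberι f s₀) (2 * M) W ∈ algebraicClasses (fiberOver f s₀) M) →
      ∀ s : ComplexPoints C, complexBetti.map (fiberι f s) (2 * M) W ∈ algebraicClasses (fiberOver f s) M := by
  intro 𝒳 C f e he hf hirr haff hsm hdim W hW hA hanch s
  haveI := haff
  haveI := hsm
  have hqp : IsQuasiProjectiveOver 𝒳 :=
    isQuasiProjectiveOver_of_sectioned_abelianFibres f e he hf fun t => by
      obtain ⟨A', -, -, -, h⟩ := hA t
      exact ⟨A', h⟩
  exact mem_algebraicClasses_of_not_countable_curve f hf hqp hdim W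
    (stub_anchorSpreadsUncountably p M hp hp4 hp7 hM f e he hf hqp hirr haff hsm hdim W hW hA hanch) s

/-- COMPOSITION: the crux by name — `M = 1` by Lefschetz `(1,1)` (`weilVariationalHodge_iff_two_le`), affine
reduction (`stub_affineReduction`), sectioned-curve reduction (`stub_sectionedCurveReduction`, landed), then
`weilRung_sectionedCurve`. -/
theorem WeilVariationalHodge_of : HeckePrymWeil.WeilVariationalHodge :=
  weilVariationalHodge_iff_two_le.2 fun p hp hp4 hp7 M hM =>
    stub_affineReduction p M (stub_sectionedCurveReduction p M (weilRung_sectionedCurve p M hp hp4 hp7 hM))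

end Summit.HodgeConjecture.HodgeConjecture.Theorems

end
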